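import Literature.NumberTheory.GaloisRepresentations.SerreSL2Lifting
import Mathlib.LinearAlgebra.Matrix.NonsingularInverse
import Mathlib.RingTheory.Nilpotent.Basic
import HarnessLib

/-!
# `−1` lifts: a subgroup of `GL₂(ℤ/p^N ℤ)` whose reduction modulo `p` contains `−1` contains `−1`
# (`p` odd)

Summits-side helper (our own group lemma, not a published statement — hence not under `Literature/`),
cell `pub/bsd-wall`, width seat `bsd-wall-soed-p1-w3` g15, `--supports stmt-BirchSwinnertonDyer-26610`; theorems
only (no definitions, no named facts, no `sorry`). Companion to `Literature.NumberTheory.GaloisRepresentations.SerreSL2Lifting` (Serre's lemma from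
level `p`, `p ≥ 5`) and `…SerreGL2LiftingLevelPSquared` (from level `p²`, `p` odd). Unlike those two
lemmas, NO surjectivity is assumed here: for ANY subgroup `H ≤ GL₂(ℤ/p^N ℤ)` (`p` odd, `N ≥ 1`)
containing an element `h` that reduces to `−1` modulo `p`, the scalar `−1` itself lies in `H`
(`GL2NegOneLifting.neg_one_mem_of_map_eq_neg_one`). In particular the `3`-adic image of an elliptic curve
with `ρ̄_{E,3}` onto (hence `−1 ∈ GL₂(𝔽₃)` in the image; over `K` imaginary quadratic with `d_K ≠ −3`
still `−1 ∈ SL₂(𝔽₃) = ρ̄(G_K)`) contains `−1` at EVERY level `3^N` — also on the curves that are onto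
modulo `3` but not modulo `9` (N. D. Elkies, arXiv:math/0612734), where Serre's lemma fails. This is
the group-theoretic input behind `H¹(Gal(K(E[p^M])/K), E[p^M]) = 0` (a central element acting as `−1`
kills `H¹` when `2` is invertible) in Kolyvagin's method at level `p^M` under the PRINTED mod-`p` image
hypothesis of W. G. McCallum, *Kolyvagin's work on Shafarevich–Tate groups* (LMS LN 153, 1991), §3 (2)
and §5 — see the REMARK in the docstring of
`Literature.NumberTheory.EllipticCurves.McCallum1991_pow_dvd_card_sha_primary_of_certificate_modP`.

## Proof

Write `R = ℤ/p^N ℤ`. Reduction is a group homomorphism, so `g = h^{p^{N-1}} ∈ H` reduces to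
`(−1)^{p^{N−1}} = −1` (`p` odd), i.e. `g = −1 + pC`; and `g² = (h²)^{p^{N−1}}` with `h² = 1 + pD`
(square of `−1 + pC₀`), so `g² = 1` by the `p`-th power trick `(1 + p^k w + p^{k+1}V)^p =
1 + p^{k+1} w + p^{k+2} V'` (`Serre1968.exists_pow_eq_one_add_of_one_le`, reused) iterated up to
`p^N = 0`. Finally `(g − 1)(g + 1) = g² − 1 = 0` with `g − 1 = −2 + pC` a unit (`−2` is a unit as
`p` is odd, `pC` is nilpotent and central-commuting), hence `g + 1 = 0`, `g = −1 ∈ H`.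

## References

* [McCallumLMS1991] W. G. McCallum, *Kolyvagin's work on Shafarevich–Tate groups*, LMS LN 153
  (1991), §3 (2) p. 298, §5 p. 303 (held: `book:editornd-l-functions-arithmetic` p0279, p0284).
* [GrossLMS1991] B. H. Gross, *Kolyvagin's work on modular elliptic curves*, ibid., Prop. 9.1.
* [Elkies2006ThreeAdic] N. D. Elkies, arXiv:math/0612734, §0.
-/

open scoped MatrixGroups

set_option linter.dupNamespace false -- `Summit.BirchSwinnertonDyer.BirchSwinnertonDyer.Theorems.…` (summit = sub, D-0017)

namespace Summit.BirchSwinnertonDyer.BirchSwinnertonDyer.Theorems.GL2NegOneLifting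

open Literature.NumberTheory.GaloisRepresentations.Serre1968

section NegOne

open Matrix

variable {p N : ℕ} [Fact p.Prime]

/-- `(1 + pD)^{p^j} = 1 + p^{j+1} D_j` over `ℤ/p^N ℤ` (`p` odd), by the `p`-th power trick
`Serre1968.exists_pow_eq_one_add_of_one_le` iterated. [folklore] -/
private theorem exists_one_add_smul_pow_pow_eq (hp2 : p ≠ 2) (D : Matrix (Fin 2) (Fin 2) (ZMod (p ^ N)))
    (j : ℕ) : ∃ D' : Matrix (Fin 2) (Fin 2) (ZMod (p ^ N)),
      (1 + (p : ZMod (p ^ N)) • D) ^ (p ^ j) = 1 + ((p : ZMod (p ^ N)) ^ (j + 1)) • D' := by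
  have hp : p.Prime := Fact.out
  have hp2' : 2 < p := lt_of_le_of_ne hp.two_le (Ne.symm hp2)
  induction j with
  | zero => exact ⟨D, by rw [pow_zero, pow_one, zero_add, pow_one]⟩
  | succ j ih =>
    obtain ⟨D', hD'⟩ := ih
    obtain ⟨V', hV'⟩ := exists_pow_eq_one_add_of_one_le (R := ZMod (p ^ N)) hp hp2'
      (k := j + 1) (by omega) D' (0 : Matrix (Fin 2) (Fin 2) (ZMod (p ^ N)))
    refine ⟨D' + (p : ZMod (p ^ N)) • V', ?_⟩
    rw [pow_succ, pow_mul, hD']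
    have e : j + 1 + 2 = j + 1 + 1 + 1 := rfl
    rw [smul_zero, add_zero, e] at hV'
    rw [hV', smul_add, smul_smul, ← pow_succ, add_assoc]

/-- **`−1` lifts along reduction modulo `p` (`p` odd).** For `N ≥ 1` and ANY subgroup
`H ≤ GL₂(ℤ/p^N ℤ)`: if some `h ∈ H` reduces to `−1 ∈ GL₂(ℤ/p ℤ)`, then `−1 ∈ H`. No surjectivity
hypothesis (contrast Serre's lemma, which at `p = 3` needs level `9`). Proof in the module docstring.
[cite: McCallumLMS1991, §3 (2) (p. 298)] [cite: Elkies2006ThreeAdic, §0] -/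
theorem neg_one_mem_of_map_eq_neg_one (hp2 : p ≠ 2) (hN : N ≠ 0)
    (H : Subgroup (GL (Fin 2) (ZMod (p ^ N)))) {h : GL (Fin 2) (ZMod (p ^ N))} (hh : h ∈ H)
    (hred : GeneralLinearGroup.map (ZMod.castHom (dvd_pow_self p hN) (ZMod p)) h = -1) :
    (-1 : GL (Fin 2) (ZMod (p ^ N))) ∈ H := by
  have hp : p.Prime := Fact.out
  set f := ZMod.castHom (dvd_pow_self p hN) (ZMod p) with hf
  -- reduction of `-1`
  have hneg1 : ((-1 : GL (Fin 2) (ZMod p)) : Matrix (Fin 2) (Fin 2) (ZMod p)) =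
      (-1 : Matrix (Fin 2) (Fin 2) (ZMod (p ^ N))).map f := by
    rw [Units.val_neg, Units.val_one, Matrix.map_neg _ (fun a ↦ map_neg f a),
      Matrix.map_one _ (map_zero f) (map_one f)]
  -- an element of `GL₂(ℤ/p^N)` reducing to `-1` is `-1 + pC`
  have key : ∀ u : GL (Fin 2) (ZMod (p ^ N)), GeneralLinearGroup.map f u = -1 →
      ∃ C : Matrix (Fin 2) (Fin 2) (ZMod (p ^ N)),
        (u : Matrix (Fin 2) (Fin 2) (ZMod (p ^ N))) = -1 + (p : ZMod (p ^ N)) • C := by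
    intro u hu
    apply exists_eq_add_smul_of_map_eq hN
    have h1 := congrArg (fun v : GL (Fin 2) (ZMod p) ↦ (v : Matrix (Fin 2) (Fin 2) (ZMod p))) hu
    rw [hneg1] at h1
    exact h1
  -- `g := h ^ (p ^ (N-1))` lies in `H` and reduces to `-1`
  set g : GL (Fin 2) (ZMod (p ^ N)) := h ^ (p ^ (N - 1)) with hg
  have hgH : g ∈ H := H.pow_mem hh _
  have hodd : Odd (p ^ (N - 1)) := (hp.odd_of_ne_two hp2).pow
  have hgred : GeneralLinearGroup.map f g = -1 := by
    rw [hg, map_pow, hred, hodd.neg_one_pow]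
  obtain ⟨C, hC⟩ := key g hgred
  obtain ⟨C₀, hC₀⟩ := key h hred
  -- `h² = 1 + pD`
  set Mh : Matrix (Fin 2) (Fin 2) (ZMod (p ^ N)) := (h : Matrix (Fin 2) (Fin 2) (ZMod (p ^ N))) with hMh
  have hsq : Mh * Mh = 1 + (p : ZMod (p ^ N)) • (-(C₀ + C₀) + (p : ZMod (p ^ N)) • (C₀ * C₀)) := by
    have hX2 : ((p : ZMod (p ^ N)) • C₀) * ((p : ZMod (p ^ N)) • C₀) =
        (p : ZMod (p ^ N)) • ((p : ZMod (p ^ N)) • (C₀ * C₀)) := by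
      rw [smul_mul_assoc, mul_smul_comm]
    rw [hC₀, smul_add, smul_neg, smul_add, ← hX2]
    generalize (p : ZMod (p ^ N)) • C₀ = Y
    noncomm_ring
  -- hence `g² = 1`
  obtain ⟨D', hD'⟩ := exists_one_add_smul_pow_pow_eq hp2
    (-(C₀ + C₀) + (p : ZMod (p ^ N)) • (C₀ * C₀)) (N - 1)
  have hpN : ((p : ZMod (p ^ N)) ^ (N - 1 + 1)) = 0 := by
    rw [Nat.sub_add_cancel (Nat.one_le_iff_ne_zero.mpr hN)]
    exact natCast_pow_eq_zero
  rw [hpN, zero_smul, add_zero, ← hsq] at hD'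
  -- hD' : (Mh * Mh) ^ (p ^ (N-1)) = 1
  have hG2 : (g : Matrix (Fin 2) (Fin 2) (ZMod (p ^ N))) * (g : Matrix (Fin 2) (Fin 2) (ZMod (p ^ N))) = 1 := by
    rw [hg, Units.val_pow_eq_pow_val, ← hMh, ← (Commute.refl Mh).mul_pow, hD']
  -- `g - 1 = -2 + pC` is a unit
  set G : Matrix (Fin 2) (Fin 2) (ZMod (p ^ N)) := (g : Matrix (Fin 2) (Fin 2) (ZMod (p ^ N))) with hGdef
  have hcop : Nat.Coprime 2 (p ^ N) :=
    ((Nat.coprime_primes Nat.prime_two hp).mpr (Ne.symm hp2)).pow_right N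
  have h2u : IsUnit (2 : Matrix (Fin 2) (Fin 2) (ZMod (p ^ N))) := by
    have h2 : IsUnit ((2 : ℕ) : ZMod (p ^ N)) := by
      rw [← ZMod.coe_unitOfCoprime 2 hcop]
      exact Units.isUnit _
    have := h2.map (algebraMap (ZMod (p ^ N)) (Matrix (Fin 2) (Fin 2) (ZMod (p ^ N))))
    rwa [map_natCast, Nat.cast_ofNat] at this
  have hnil : IsNilpotent ((p : ZMod (p ^ N)) • C) :=
    ⟨N, by rw [smul_pow, natCast_pow_eq_zero, zero_smul]⟩
  have hcomm : Commute ((p : ZMod (p ^ N)) • C) (-(2 : Matrix (Fin 2) (Fin 2) (ZMod (p ^ N)))) := by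
    have h2c := (Nat.cast_commute 2 ((p : ZMod (p ^ N)) • C)).symm
    rw [Nat.cast_ofNat] at h2c
    exact h2c.neg_right
  have hunit : IsUnit (G - 1) := by
    have hG1 : G - 1 = -(2 : Matrix (Fin 2) (Fin 2) (ZMod (p ^ N))) + (p : ZMod (p ^ N)) • C := by
      have h2 : (2 : Matrix (Fin 2) (Fin 2) (ZMod (p ^ N))) = 1 + 1 := one_add_one_eq_two.symm
      rw [hC, h2]; abel
    rw [hG1]
    exact hnil.isUnit_add_left_of_commute h2u.neg hcomm
  -- `(g - 1)(g + 1) = g² - 1 = 0`, so `g + 1 = 0`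
  have hprod : (G - 1) * (G + 1) = 0 := by
    have : (G - 1) * (G + 1) = G * G - 1 := by noncomm_ring
    rw [this, hG2, sub_self]
  have hG : G = -1 := by
    have h0 : G + 1 = 0 := (hunit.mul_right_eq_zero).mp hprod
    exact eq_neg_of_add_eq_zero_left h0
  -- conclude
  have hgm1 : g = -1 := Units.ext (by rw [← hGdef, hG, Units.val_neg, Units.val_one])
  exact hgm1 ▸ hgH

/-- **Corollary (subgroups with full reduction, or any reduction containing `−1`).** If the image of
`H ≤ GL₂(ℤ/p^N ℤ)` under reduction modulo `p` contains `−1` (e.g. `H` maps ONTO `GL₂(𝔽_p)`, or onto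
`SL₂(𝔽_p)`), then `−1 ∈ H` (`p` odd, `N ≥ 1`). [cite: McCallumLMS1991, §3 (2) (p. 298)] -/
theorem neg_one_mem_of_neg_one_mem_map (hp2 : p ≠ 2) (hN : N ≠ 0)
    (H : Subgroup (GL (Fin 2) (ZMod (p ^ N))))
    (hH : (-1 : GL (Fin 2) (ZMod p)) ∈ H.map (GeneralLinearGroup.map (ZMod.castHom (dvd_pow_self p hN) (ZMod p)))) :
    (-1 : GL (Fin 2) (ZMod (p ^ N))) ∈ H := by
  obtain ⟨h, hh, hred⟩ := Subgroup.mem_map.mp hH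
  exact neg_one_mem_of_map_eq_neg_one hp2 hN H hh hred

end NegOne

end Summit.BirchSwinnertonDyer.BirchSwinnertonDyer.Theorems.GL2NegOneLifting
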